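import Summits.QuantumFields.YangMills.Theses.FradkinShenkerFlow
import Summits.QuantumFields.YangMills.Theorems.FradkinShenkerFlowSusceptibilityToPoincareTransfer
import Summits.QuantumFields.YangMills.Theorems.FradkinShenkerFlowSusceptibilityToPoincareElitzurBessel
import Summits.QuantumFields.YangMills.Theorems.FradkinShenkerFlowSusceptibilityToPoincareLinkSetPoincare
import Summits.QuantumFields.YangMills.Theorems.FradkinShenkerFlowSusceptibilityToPoincarePinnedClusterBound
import Summits.QuantumFields.YangMills.Theorems.FradkinShenkerFlowSusceptibilityToPoincareFreeClusterTail
import Summits.QuantumFields.YangMills.Theorems.FradkinShenkerFlowSusceptibilityToPoincarePlantedTerminal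

/-!
# Line `planted-link-pinning` — lead's skeleton for crux stmt-QuantumFields-9441
(`Summit.QuantumFields.YangMills.Theses.FradkinShenkerFlow.SusceptibilityToPoincare`, FS(β) ⇒ UP(β))

Lead `prover-line-stmt-QuantumFields-9441-1` (gen-1 continuation, PICKED 2026-08-16): the planner's checked skeleton
`Cruxes/SusceptibilityToPoincare/Lines/planted-link-pinning.lean` (planner-cruxplan-…-planted-link-pinning-0; 5 stubs
S1–S5) OWNED and RESHAPED for the wave:

* S1 `stub_orbitSlice` (UP_inv ⇒ UP) is CLOSED — it is the landed transfer theorem of line orbit-slice-reduction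
  (`Theorems.SusceptibilityToPoincare.transfer_upInv_up`, p80192; no `0 ≤ β` needed), see `orbitSlice` below.
* S2 `stub_elitzurBessel` (registered, M+; LANDED p99498 — `Theorems/FradkinShenkerFlowSusceptibilityToPoincareElitzurBessel.lean`): distinct links are pairwise independent under the torus Wilson measure of side
  `2S+1 ≥ 3` (gauge rotation at a free endpoint + invariance of Haar), hence Bessel: `Σ_ℓ Var(E[φ|U_ℓ]) ≤ Var φ`.
* S3 `stub_plantedTerminal` of the planner (planted terminal Poincaré `PCV_ε(F) ≤ C·ℰ_hb(F)` for `ε ≤ ε₀(β)`) is RESHAPED into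
  four registered stubs whose composition is S3 verbatim:
  - S3c `stub_linkSetPoincare` (M; LANDED p97050 — `…LinkSetPoincare.lean`): residual variance given the links OFF a finite link set `D` is at most
    `A·B^{#D}·Σ_{ℓ∈D} hb_ℓ(F)` — Holley–Stroock + Efron–Stein inside the DLR kernel of `D` + Haar→heat-bath resampling
    (the landed `LocalPoincare.integral_sub_condExp_sq_le`, p85508/p78986, for an arbitrary link set instead of a cylinder);
  - S3d `stub_pinnedClusterBound` (L; LANDED p100089 — `…PinnedClusterBound.lean`): for FIXED pins `Λ` and any labelling `c` of the free links that is constant on free links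
    sharing a plaquette, `E(F − E[F|U_Λ])² ≤ Σ_{ℓ free} A·B^{#block(ℓ)}·hb_ℓ(F)` — conditional independence of the label blocks
    given the pins (locality of the DLR kernels, `TorusWilsonGibbs`/`TorusWilsonMarkov`), block Efron–Stein along the block
    filtration (martingale increments + L²-contraction), and S3c per block (taken as a hypothesis);
  - S3e `stub_freeClusterTail` (L; LANDED p101657 — `…FreeClusterTail.lean`; pure combinatorics of the torus link set): there is a plaquette-closed labelling (connected
    components of a bounded-degree link graph) whose planted block-size exponential moment `Σ_{Λ∌ℓ} ε^{|Λᶜ|}(1−ε)^{|Λ|} B^{#block}`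
    is bounded uniformly in the volume for `ε ≤ ε₀(B)` (closed-walk witnesses for large clusters, `≤ Δ^{2k}` walks, Bernoulli
    marginals `ε^{#vertices}`);
  - S3f `stub_plantedTerminal` (M; LANDED — `…PlantedTerminal.lean`; hence S3 is the unconditional theorem `plantedTerminal_holds` of `…PlantedTerminalHolds.lean`): S3c ∧ S3d ∧ S3e ⇒ S3 (exchange of the two finite sums, `∫ condVar = E(F − E[F|·])²`,
    `⨆_{ℓ∈Λ} σ(U_ℓ) = cylinderEvents Λ`).
* S4 `stub_plantedLocalToGlobal` (registered, HELD BY THE LEAD; OPEN — the crux's content in the line's form, simply-connected G;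
  FALSE AS TYPED modulo the SU(2) twist inputs + `SimplyConnectedSpace SU(2)`: `Negative.stub_plantedLocalToGlobal_false_of_twistInputsSU2`).
* S5 `stub_centrelessResidual` (registered scope sentinel, NOT staffed; false modulo `TwistSectorInputs`:
  `Negative.stub_centrelessResidual_false_of_twistSectorInputs`).

All registered signatures are spelled over tree/Mathlib declarations only (`wilsonMeasure`, `wilsonAction`, `haarProbability`,
`Measure.tilted`, `condExp`/`condVar`, `cylinderEvents`, `MeasurableSpace.comap`, `Site.shift`, `Finset.filter`), with the
measure introduced by a `μW = wilsonMeasure r.ρ β →` binder (no `:=` inside a signature).  `SusceptibilityToPoincare_of`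
concludes the crux BY NAME; after wave 1 its only `sorryAx` comes from S4 and S5.

Disproof.lean (cdisprove v3, read 2026-08-16T10:30Z) honoured: §1 bottleneck / §2 ¬crux modulo H = `TwistSectorInputs`
(p76563) bite only through S5 (π₁(G) ≠ 0) and — via drefute's SU(2) mixed-action witness p77766 (`Negative/TwistSectorSimplyConnected`)
— through S4 AS TYPED (all β ≥ 0, all faithful r): S4 ∘ S1–S3 gives UP_inv on simply-connected G, which p77766 refutes modulo
SU(2) twist inputs in the Bhanot–Creutz window; the lead records the re-typing (`∃ β₁ ∀ β ≥ β₁` or `r` irreducible) with the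
planner, S1–S3 and S5 being untouched by it.  §4 ("per-S Poincaré true; content = uniformity in S"): S2, S3c–S3f are uniform in
S by construction; `0 ≤ β` is carried only by S4/S5 (S2/S3 hold for every real β).  No `_false_without_` theorem exists; no
`-- Targets` entry names a stub of this line yet.
-/

namespace Summit.QuantumFields.YangMills.Cruxes.SusceptibilityToPoincare.PlantedLinkPinning

open MeasureTheory ProbabilityTheory
open Literature.MathematicalPhysics.QuantumFieldTheory

noncomputable section

/-! ### §0 Vocabulary (transparent names for verbatim sub-formulas; used only in the sorry-free composition) -/

section Vocabulary

variable {G : Type} [Group G] [TopologicalSpace G] [IsTopologicalGroup G] [CompactSpace G]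
  [MeasurableSpace G] [BorelSpace G]

/-- FS(r, β): finite gauge-invariant susceptibility uniformly in the volume — verbatim the crux hypothesis. -/
def FS (r : LatticeRep G) (β : ℝ) : Prop :=
  ∀ A B : YMSpecies G, ∃ χ : ℝ, ∀ S : ℕ, ∑ x ∈ Literature.Probability.LatticeModels.box 4 S,
    |covariance (fun U => A.F (Literature.MathematicalPhysics.QuantumLattice.torusLift (2 * S + 1) U))
      (fun U => B.F (Literature.MathematicalPhysics.QuantumLattice.configShift (-x)
          (Literature.MathematicalPhysics.QuantumLattice.torusLift (2 * S + 1) U)))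
      (wilsonMeasure (d := 4) (L := 2 * S + 1) r.ρ β)| ≤ χ

/-- UP(r, β): the uniform single-link heat-bath Poincaré inequality for ALL bounded measurable `F` — verbatim the
crux conclusion. -/
def UP (r : LatticeRep G) (β : ℝ) : Prop :=
  ∃ C : ℝ, ∀ S : ℕ, ∀ F : GaugeConfig 4 (2 * S + 1) G → ℝ, Measurable F → (∃ M : ℝ, ∀ U, |F U| ≤ M) →
    variance F (wilsonMeasure (d := 4) (L := 2 * S + 1) r.ρ β) ≤
      C * ∑ ℓ : Edge 4 (2 * S + 1), ∫ U, ∫ g, (F U - F (Function.update U ℓ g)) ^ 2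
        ∂((haarProbability G).tilted (fun g' => -β * wilsonAction r.ρ (Function.update U ℓ g')))
        ∂(wilsonMeasure (d := 4) (L := 2 * S + 1) r.ρ β)

/-- UP_inv(r, β): the same inequality for gauge-INVARIANT bounded measurable `F` only. -/
def UPInv (r : LatticeRep G) (β : ℝ) : Prop :=
  ∃ C : ℝ, ∀ S : ℕ, ∀ F : GaugeConfig 4 (2 * S + 1) G → ℝ, Measurable F → (∃ M : ℝ, ∀ U, |F U| ≤ M) →
    IsGaugeInvariant F →
    variance F (wilsonMeasure (d := 4) (L := 2 * S + 1) r.ρ β) ≤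
      C * ∑ ℓ : Edge 4 (2 * S + 1), ∫ U, ∫ g, (F U - F (Function.update U ℓ g)) ^ 2
        ∂((haarProbability G).tilted (fun g' => -β * wilsonAction r.ρ (Function.update U ℓ g')))
        ∂(wilsonMeasure (d := 4) (L := 2 * S + 1) r.ρ β)

/-- EB(r, β): Elitzur–Bessel spectral independence of the unpinned measures (the statement of S2, `μW`-form). -/
def EB (r : LatticeRep G) (β : ℝ) : Prop :=
  ∀ (S : ℕ), 1 ≤ S → ∀ (μW : Measure (GaugeConfig 4 (2 * S + 1) G)),
    μW = (wilsonMeasure r.ρ β : Measure (GaugeConfig 4 (2 * S + 1) G)) →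
    ∀ φ : GaugeConfig 4 (2 * S + 1) G → ℝ, Measurable φ → (∃ M : ℝ, ∀ U, |φ U| ≤ M) →
    ∑ ℓ : Edge 4 (2 * S + 1),
        variance (μW[φ | MeasurableSpace.comap (fun V : GaugeConfig 4 (2 * S + 1) G => V ℓ) inferInstance]) μW ≤
      variance φ μW

/-- `PlantedTerminal r β`: the planted terminal comparison `PCV_ε(F) ≤ C·ℰ_hb(F)` at all small free densities (S3, `μW`-form). -/
def PlantedTerminal (r : LatticeRep G) (β : ℝ) : Prop :=
  ∃ ε₀ : ℝ, 0 < ε₀ ∧ ε₀ < 1 ∧ ∀ ε : ℝ, 0 < ε → ε ≤ ε₀ → ∃ C : ℝ, 0 ≤ C ∧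
    ∀ (S : ℕ) (μW : Measure (GaugeConfig 4 (2 * S + 1) G)),
    μW = (wilsonMeasure r.ρ β : Measure (GaugeConfig 4 (2 * S + 1) G)) →
    ∀ (F : GaugeConfig 4 (2 * S + 1) G → ℝ), Measurable F → (∃ M : ℝ, ∀ U, |F U| ≤ M) →
    (∑ Λ : Finset (Edge 4 (2 * S + 1)),
      ε ^ (Fintype.card (Edge 4 (2 * S + 1)) - Λ.card) * (1 - ε) ^ Λ.card *
        ∫ U, condVar (⨆ ℓ ∈ Λ, MeasurableSpace.comap (fun V : GaugeConfig 4 (2 * S + 1) G => V ℓ) inferInstance)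
          F μW U ∂μW) ≤
      C * ∑ ℓ : Edge 4 (2 * S + 1), ∫ U, ∫ g, (F U - F (Function.update U ℓ g)) ^ 2
        ∂((haarProbability G).tilted (fun g' => -β * wilsonAction r.ρ (Function.update U ℓ g'))) ∂μW

/-- `PlantedLocalToGlobal r β`: the planted local-to-global inequality for gauge-invariant `F` at some free density below
any prescribed `ε₀` (the conclusion of S4, `μW`-form). -/
def PlantedLocalToGlobal (r : LatticeRep G) (β : ℝ) : Prop :=
  ∀ ε₀ : ℝ, 0 < ε₀ → ∃ ε : ℝ, 0 < ε ∧ ε ≤ ε₀ ∧ ∃ C : ℝ, 0 ≤ C ∧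
    ∀ (S : ℕ) (μW : Measure (GaugeConfig 4 (2 * S + 1) G)),
    μW = (wilsonMeasure r.ρ β : Measure (GaugeConfig 4 (2 * S + 1) G)) →
    ∀ (F : GaugeConfig 4 (2 * S + 1) G → ℝ), Measurable F → (∃ M : ℝ, ∀ U, |F U| ≤ M) →
    IsGaugeInvariant F →
    variance F μW ≤
      C * ∑ Λ : Finset (Edge 4 (2 * S + 1)),
        ε ^ (Fintype.card (Edge 4 (2 * S + 1)) - Λ.card) * (1 - ε) ^ Λ.card *
          ∫ U, condVar (⨆ ℓ ∈ Λ, MeasurableSpace.comap (fun V : GaugeConfig 4 (2 * S + 1) G => V ℓ) inferInstance)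
            F μW U ∂μW

end Vocabulary

/-- The crux, re-read through `FS`/`UP` (definitional). -/
theorem crux_iff :
    Summit.QuantumFields.YangMills.Theses.FradkinShenkerFlow.SusceptibilityToPoincare ↔
      ∀ (G : Type) [Group G] [TopologicalSpace G] [IsTopologicalGroup G] [CompactSpace G]
        [MeasurableSpace G] [BorelSpace G], IsCompactSimpleLieGroup G →
        ∀ (r : LatticeRep G) (β : ℝ), 0 ≤ β → FS r β → UP r β :=
  Iff.rfl

/-! ### §1 S1 is a theorem: the orbit–slice transfer UP_inv ⇒ UP (landed, p80192) -/

/-- **S1 · orbit–slice reduction `UP_inv ⇒ UP`** — for EVERY compact `G` with a lattice representation and EVERY real `β`: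
this is `Theorems.SusceptibilityToPoincare.transfer_upInv_up` (line orbit-slice-reduction, p80192). -/
theorem orbitSlice (G : Type) [Group G] [TopologicalSpace G] [IsTopologicalGroup G] [CompactSpace G]
    [MeasurableSpace G] [BorelSpace G] (r : LatticeRep G) (β : ℝ) : UPInv r β → UP r β :=
  Summit.QuantumFields.YangMills.Theorems.SusceptibilityToPoincare.transfer_upInv_up G r β

/-! ### §2 The registered stubs (`sorry` only here) -/

/-- `stub_elitzurBessel` — **S2 · Elitzur–Bessel: the unpinned torus Wilson measure is spectrally independent with constant 1**
(size M+; TRUE for every compact `G`, every real `β`, every side `2S+1 ≥ 3`).  For bounded measurable `φ`,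
`Σ_ℓ Var_μ(E_μ[φ | σ(U_ℓ)]) ≤ Var_μ φ`.
Proof. (i) PAIRWISE INDEPENDENCE OF DISTINCT LINKS: for `ℓ ≠ ℓ'` on the torus of side `2S+1 ≥ 3` one of the two links has an
endpoint `z` that is not an endpoint of the other (else `{x, x+e_i} = {y, y+e_j}` forces `ℓ = ℓ'` or `2 = 0 (mod 2S+1)`); the
gauge transformation `γ = update 1 z g` maps `U_ℓ ↦ g·U_ℓ` (or `U_ℓ·g⁻¹`) and fixes `U_ℓ'`, and `μ` is `γ`-invariant
(`wilsonMeasure_map_gaugeTransform_holds`); integrating `g` over Haar (Fubini) and using right/left invariance of the Haar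
probability measure of the compact (unimodular) group, `μ(U_ℓ ∈ A, U_ℓ' ∈ B) = Haar(A)·μ(U_ℓ' ∈ B)`, so `U_ℓ ∼ Haar` and
`U_ℓ ⊥ U_ℓ'` (`ProbabilityTheory.IndepFun`).  (ii) BESSEL: `P_ℓ := E[· | σ(U_ℓ)]` restricted to centred `L²` have pairwise
orthogonal ranges (`E[f(U_ℓ) h(U_ℓ')] = E f(U_ℓ) · E h(U_ℓ') = 0` for centred `f(U_ℓ) = P_ℓ φ − Eφ`, `h(U_ℓ') = P_ℓ' φ − Eφ`,
by (i) and Doob–Dynkin `Measurable.factorsThrough` for the comap σ-algebra); with `ψ := Σ_ℓ (P_ℓ φ − Eφ)`: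
`‖ψ‖² = Σ_ℓ ‖P_ℓφ − Eφ‖² = ⟨φ − Eφ, ψ⟩ ≤ ‖φ − Eφ‖ ‖ψ‖`, whence `Σ_ℓ Var(P_ℓ φ) = ‖ψ‖² ≤ Var φ`
(`Var(P_ℓ φ) = ‖P_ℓ φ − Eφ‖²` since `E P_ℓ φ = E φ`, `integral_condExp`).  `S = 0` (side 1) is correctly excluded. -/
theorem stub_elitzurBessel :
    ∀ (G : Type) [Group G] [TopologicalSpace G] [IsTopologicalGroup G] [CompactSpace G]
      [MeasurableSpace G] [BorelSpace G] (r : LatticeRep G) (β : ℝ) (S : ℕ), 1 ≤ S →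
      ∀ (μW : Measure (GaugeConfig 4 (2 * S + 1) G)),
      μW = (wilsonMeasure r.ρ β : Measure (GaugeConfig 4 (2 * S + 1) G)) →
      ∀ φ : GaugeConfig 4 (2 * S + 1) G → ℝ, Measurable φ → (∃ M : ℝ, ∀ U, |φ U| ≤ M) →
      ∑ ℓ : Edge 4 (2 * S + 1),
          variance (μW[φ | MeasurableSpace.comap (fun V : GaugeConfig 4 (2 * S + 1) G => V ℓ) inferInstance]) μW ≤
        variance φ μW :=
  Summit.QuantumFields.YangMills.Theorems.SusceptibilityToPoincare.stub_elitzurBessel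

/-- `stub_linkSetPoincare` — **S3c · residual variance given the links off a finite link set** (size M; TRUE for every compact
`G`, real `β`).  There are `A ≥ 0`, `B ≥ 1` (depending on `G, r, β` only; e.g. `A = ½e^{c₂}`, `B = e^{2c₁}` with
`c₁ = 2|β|·5·#planes·(N + sup|Re tr ρ|)`, `c₂ = c₁`) such that on every torus, for every finite link set `D` and every bounded
measurable `F`: `E_μ(F − E_μ[F | links outside D])² ≤ A·B^{#D}·Σ_{ℓ∈D} ∫∫ (F U − F(U[ℓ↦g]))² dν_ℓ^U dμ`.
Proof = the landed `LocalPoincare.integral_sub_condExp_sq_le` (FradkinShenkerFlowSusceptibilityToPoincareLocalPoincareSmallCylinders,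
p85508) with the cylinder's link set replaced by an arbitrary `D` (the only use of the cylinder there is `#links ≤ 4m⁴`):
the conditional expectation given `cylinderEvents Dᶜ` is the DLR kernel `γ_D` of the plaquette specification
(`isGibbsMeasure_wilsonMeasure`, `exists_plaquettePotential`, `IsGibbsMeasure.condExp_ae_eq_integral` /
`stronglyMeasurable_and_ae_eq_condExp_integral_gibbsSpecOfPotential`); inside the kernel Holley–Stroock against glued product
Haar + Efron–Stein (`LocalPoincare.integral_sub_sq_kernel_le`, oscillation of the tilt `≤ 2|β|·(#D·5·#planes)(N + M_t)` by
`LocalPoincare.abs_wilsonAction_sub_le`); DLR backwards; Haar resampling of one link ≤ `e^{c₂}` × heat-bath resampling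
(`HaarResample.integral_haar_le_exp_mul_integral_heatBath`, p74627). -/
theorem stub_linkSetPoincare :
    ∀ (G : Type) [Group G] [TopologicalSpace G] [IsTopologicalGroup G] [CompactSpace G]
      [MeasurableSpace G] [BorelSpace G] (r : LatticeRep G) (β : ℝ), ∃ A B : ℝ, 0 ≤ A ∧ 1 ≤ B ∧
      ∀ (S : ℕ) (μW : Measure (GaugeConfig 4 (2 * S + 1) G)),
      μW = (wilsonMeasure r.ρ β : Measure (GaugeConfig 4 (2 * S + 1) G)) →
      ∀ (D : Finset (Edge 4 (2 * S + 1))) (F : GaugeConfig 4 (2 * S + 1) G → ℝ),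
      Measurable F → (∃ M : ℝ, ∀ U, |F U| ≤ M) →
      ∫ U, (F U - (μW[F | cylinderEvents ((↑D : Set (Edge 4 (2 * S + 1)))ᶜ)]) U) ^ 2 ∂μW ≤
        A * B ^ D.card * ∑ ℓ ∈ D, ∫ U, ∫ g, (F U - F (Function.update U ℓ g)) ^ 2
          ∂((haarProbability G).tilted (fun g' => -β * wilsonAction r.ρ (Function.update U ℓ g'))) ∂μW :=
  Summit.QuantumFields.YangMills.Theorems.SusceptibilityToPoincare.stub_linkSetPoincare

/-- `stub_pinnedClusterBound` — **S3d · residual variance given FIXED pins, through plaquette-closed blocks of free links**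
(size L; TRUE for every compact `G`, real `β`).  Hypotheses: constants `A ≥ 0`, `B ≥ 1` with the link-set bound of S3c; a pinned
set `Λ`; a labelling `c` of the links that is constant on FREE links sharing a plaquette (so the label classes
`block(ℓ) = {ℓ' ∉ Λ | c ℓ' = c ℓ}` of free links are unions of plaquette-connected free clusters).  Conclusion:
`E_μ(F − E_μ[F | U_Λ])² ≤ Σ_{ℓ ∉ Λ} A·B^{#block(ℓ)}·hb_ℓ(F)`.
Proof. Enumerate the distinct labels of free links `v₁ < ⋯ < v_n`, blocks `K_j`; filtration `𝓖_j := cylinderEvents (Λ ∪ K₁ ∪ ⋯ ∪ K_j)`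
(`𝓖_0 = cylinderEvents Λ`, `𝓖_n = cylinderEvents univ =` everything).
(a) CONDITIONAL INDEPENDENCE OF A BLOCK (Markov property of the plaquette specification): every plaquette meeting `K_j` has all
its links in `K_j ∪ Λ` (its free links share a plaquette with a link of `K_j`, hence carry the same label); therefore for bounded
`h` measurable w.r.t. `cylinderEvents K_jᶜ`, `E[h | 𝓖_j] = E[h | 𝓖_{j−1}]` a.e.  [From `TorusWilsonGibbs`:
`stronglyMeasurable_and_ae_eq_condExp_integral_gibbsSpecOfPotential` with volume `K_j` and `T = Λ ∪ K_{<j}` shows that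
`E[g | cylinderEvents K_jᶜ]` has a `𝓖_{j−1}`-measurable version for bounded `𝓖_j`-measurable `g` (the DLR kernel of `K_j` reads
only plaquettes touching `K_j`), i.e. `E[g | K_jᶜ] = E[g | 𝓖_{j−1}]`; the displayed form follows by duality
`E[g·h] = E[h·E[g|K_jᶜ]] = E[h·E[g|𝓖_{j−1}]] = E[E[h|𝓖_{j−1}]·g]` for all bounded `𝓖_j`-measurable `g`
(`ae_eq_condExp_of_forall_setIntegral_eq`); pattern: `condExp_wilsonMeasure_markov_slab` in `TorusWilsonMarkov`.]
(b) BLOCK EFRON–STEIN: `F − E[F|𝓖_0] = Σ_j d_j`, `d_j := E[F|𝓖_j] − E[F|𝓖_{j−1}]` orthogonal martingale increments, so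
`E(F − E[F|𝓖_0])² = Σ_j E d_j²`; by the tower property (`𝓖_{j−1} ≤ cylinderEvents K_jᶜ`) and (a) with `h = E[F | K_jᶜ]`,
`d_j = E[F − E[F|K_jᶜ] | 𝓖_j]`, hence `E d_j² ≤ E(F − E[F|K_jᶜ])²` (L²-contraction, `integral_condExp_sq_le_of_ae_bdd`).
(c) S3c (hypothesis) with `D = K_j`: `E(F − E[F|K_jᶜ])² ≤ A B^{#K_j} Σ_{ℓ∈K_j} hb_ℓ(F)`; regroup `Σ_j Σ_{ℓ∈K_j} = Σ_{ℓ∉Λ}` with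
`#K_j = #block(ℓ)` for `ℓ ∈ K_j`. -/
theorem stub_pinnedClusterBound :
    ∀ (G : Type) [Group G] [TopologicalSpace G] [IsTopologicalGroup G] [CompactSpace G]
      [MeasurableSpace G] [BorelSpace G] (r : LatticeRep G) (β : ℝ) (A B : ℝ), 0 ≤ A → 1 ≤ B →
      (∀ (S : ℕ) (μW : Measure (GaugeConfig 4 (2 * S + 1) G)),
        μW = (wilsonMeasure r.ρ β : Measure (GaugeConfig 4 (2 * S + 1) G)) →
        ∀ (D : Finset (Edge 4 (2 * S + 1))) (F : GaugeConfig 4 (2 * S + 1) G → ℝ),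
        Measurable F → (∃ M : ℝ, ∀ U, |F U| ≤ M) →
        ∫ U, (F U - (μW[F | cylinderEvents ((↑D : Set (Edge 4 (2 * S + 1)))ᶜ)]) U) ^ 2 ∂μW ≤
          A * B ^ D.card * ∑ ℓ ∈ D, ∫ U, ∫ g, (F U - F (Function.update U ℓ g)) ^ 2
            ∂((haarProbability G).tilted (fun g' => -β * wilsonAction r.ρ (Function.update U ℓ g'))) ∂μW) →
      ∀ (S : ℕ) (μW : Measure (GaugeConfig 4 (2 * S + 1) G)),
      μW = (wilsonMeasure r.ρ β : Measure (GaugeConfig 4 (2 * S + 1) G)) →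
      ∀ (Λ : Finset (Edge 4 (2 * S + 1))) (c : Edge 4 (2 * S + 1) → ℕ),
      (∀ (y : Site 4 (2 * S + 1)) (i j : Fin 4), i < j →
        ∀ e ∈ ({(y, i), (y.shift i, j), (y.shift j, i), (y, j)} : Finset (Edge 4 (2 * S + 1))),
        ∀ e' ∈ ({(y, i), (y.shift i, j), (y.shift j, i), (y, j)} : Finset (Edge 4 (2 * S + 1))),
        e ∉ Λ → e' ∉ Λ → c e = c e') →
      ∀ (F : GaugeConfig 4 (2 * S + 1) G → ℝ), Measurable F → (∃ M : ℝ, ∀ U, |F U| ≤ M) →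
      ∫ U, (F U - (μW[F | cylinderEvents (↑Λ : Set (Edge 4 (2 * S + 1)))]) U) ^ 2 ∂μW ≤
        ∑ ℓ ∈ Finset.univ.filter (fun ℓ : Edge 4 (2 * S + 1) => ℓ ∉ Λ),
          A * B ^ (Finset.univ.filter (fun ℓ' : Edge 4 (2 * S + 1) => ℓ' ∉ Λ ∧ c ℓ' = c ℓ)).card *
            ∫ U, ∫ g, (F U - F (Function.update U ℓ g)) ^ 2
              ∂((haarProbability G).tilted (fun g' => -β * wilsonAction r.ρ (Function.update U ℓ g'))) ∂μW :=
  Summit.QuantumFields.YangMills.Theorems.SusceptibilityToPoincare.stub_pinnedClusterBound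

/-- `stub_freeClusterTail` — **S3e · planted free clusters have an exponential moment, uniformly in the volume** (size L; pure
combinatorics/probability of the torus link set, no gauge field).  For every `B ≥ 1` there is `ε₀ ∈ (0,1)` and for every
`0 < ε ≤ ε₀` a constant `C ≥ 0` such that on EVERY torus `(ℤ/(2S+1))⁴` there is a labelling `c Λ` of the links (for each pinned
set `Λ`), constant on free links sharing a plaquette, with `Σ_{Λ ∌ ℓ} ε^{#Λᶜ}(1−ε)^{#Λ} B^{#block_Λ(ℓ)} ≤ C` for every link `ℓ`
(`block_Λ(ℓ) = {ℓ' ∉ Λ | c Λ ℓ' = c Λ ℓ}`; the sum is `E[1{ℓ free}·B^{#block(ℓ)}]` under Bernoulli pins of free density `ε`).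
Proof. GRAPH: on the links put the BOX adjacency `ℓ ∼ ℓ' ⇔ ℓ ≠ ℓ' ∧ ∀ ν, (ℓ.1 ν − ℓ'.1 ν) ∈ {−1, 0, 1}` (degree `≤ Δ := 4·3⁴ − 1`:
image of `({−1,0,1}⁴) × Fin 4`); two links of one plaquette `{(y,i),(y+e_i,j),(y+e_j,i),(y,j)}` are box-adjacent, so the
labelling `c Λ ℓ :=` (index of) the connected component of `ℓ` in the subgraph induced on `Λᶜ` (`SimpleGraph.induce`,
`ConnectedComponent`, `Fintype.equivFin`; any value on `Λ`) is plaquette-closed, and `block_Λ(ℓ) =` that component.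
WITNESS: if the component of `ℓ` in `Λᶜ` has `≥ k` vertices then there is a CLOSED WALK at `ℓ` in the full box graph of length
`≤ 2(k−1)` all of whose vertices are free and which visits `≥ k` distinct vertices (induction on `k`: given such a walk `W` with
exactly `k−1 < #component` distinct vertices, `SimpleGraph.Walk.exists_boundary_dart` on a walk inside the component from `ℓ` to a
vertex off `W.support` gives an edge `u–u'` with `u ∈ W.support`, `u'` free and new; splice `u → u' → u` into `W` at `u`
(`takeUntil`/`dropUntil`/`append`): length `+2`, one more vertex).  COUNT: walks of length `m` from `ℓ` number `≤ Δ^m`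
(induction on `m`), so witnesses for `k` number `≤ Σ_{m ≤ 2k−2} Δ^m ≤ (Δ+1)^{2k−2}`.  BERNOULLI MARGINAL: for a fixed vertex set `V`,
`Σ_{Λ ⊆ Vᶜ} ε^{#Λᶜ}(1−ε)^{#Λ} = ε^{#V}` (`Finset.sum_pow_mul_eq_add_pow` on `Vᶜ`), and `#V ≥ k` gives `≤ ε^k` (`ε ≤ 1`).
SUM: `B^{#block} ≤ Σ_{k=1}^{#E} B^k·1{#block ≥ k}` (`B ≥ 1`), so the planted moment is
`≤ Σ_{k ≥ 1} B^k (Δ+1)^{2k−2} ε^k ≤ Σ_k ((Δ+1)² B ε)^k ≤ 1 =: C` once `ε ≤ ε₀ := 1/(2(Δ+1)²B)`. -/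
theorem stub_freeClusterTail :
    ∀ (B : ℝ), 1 ≤ B → ∃ ε₀ : ℝ, 0 < ε₀ ∧ ε₀ < 1 ∧ ∀ ε : ℝ, 0 < ε → ε ≤ ε₀ → ∃ C : ℝ, 0 ≤ C ∧
      ∀ (S : ℕ), ∃ c : Finset (Edge 4 (2 * S + 1)) → Edge 4 (2 * S + 1) → ℕ,
        (∀ (Λ : Finset (Edge 4 (2 * S + 1))) (y : Site 4 (2 * S + 1)) (i j : Fin 4), i < j →
          ∀ e ∈ ({(y, i), (y.shift i, j), (y.shift j, i), (y, j)} : Finset (Edge 4 (2 * S + 1))),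
          ∀ e' ∈ ({(y, i), (y.shift i, j), (y.shift j, i), (y, j)} : Finset (Edge 4 (2 * S + 1))),
          e ∉ Λ → e' ∉ Λ → c Λ e = c Λ e') ∧
        ∀ ℓ : Edge 4 (2 * S + 1),
          ∑ Λ ∈ (Finset.univ : Finset (Finset (Edge 4 (2 * S + 1)))).filter (fun Λ => ℓ ∉ Λ),
            ε ^ (Fintype.card (Edge 4 (2 * S + 1)) - Λ.card) * (1 - ε) ^ Λ.card *
              B ^ (Finset.univ.filter (fun ℓ' : Edge 4 (2 * S + 1) => ℓ' ∉ Λ ∧ c Λ ℓ' = c Λ ℓ)).card ≤ C :=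
  Summit.QuantumFields.YangMills.Theorems.SusceptibilityToPoincare.stub_freeClusterTail

/-- `stub_plantedTerminal` — **S3f · planted terminal stage (S3 of the planner, verbatim conclusion) from S3c, S3d, S3e**
(size M; sorry-free logic + exchange of two finite sums).  For every compact `G`, `r`, real `β`: the link-set bound (S3c-statement),
the fixed-pin block bound (S3d-statement) and the free-cluster tail (S3e-statement) imply: `∃ ε₀ ∈ (0,1) ∀ ε ∈ (0,ε₀] ∃ C ≥ 0 ∀ S`,
bounded measurable `F`: `PCV_ε(F) := Σ_Λ ε^{#Λᶜ}(1−ε)^{#Λ} ∫ Var_μ[F | σ(U_Λ)] dμ ≤ C·Σ_ℓ hb_ℓ(F)`.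
Proof. Get `A, B` from S3c; `ε₀, C_T, c` from S3e at this `B`; for `ε ≤ ε₀` and each `Λ`:
`∫ condVar(⨆_{ℓ∈Λ} σ(U_ℓ)) F dμ = ∫ (F − μ[F | cylinderEvents ↑Λ])² dμ` (`ProbabilityTheory.condVar`, `integral_condExp`,
integrability from boundedness; `⨆ ℓ ∈ Λ, comap (· ℓ) = cylinderEvents ↑Λ` definitionally up to `Finset.mem_coe`); S3d with the
labelling `c Λ` bounds it by `Σ_{ℓ∉Λ} A B^{#block_Λ(ℓ)} hb_ℓ(F)`; multiply by the non-negative weights (`0 < ε ≤ ε₀ < 1`), sum over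
`Λ`, exchange the sums (`Finset.sum_comm`, `Finset.sum_filter`), and bound `Σ_{Λ∌ℓ} w_ε(Λ) B^{#block_Λ(ℓ)} ≤ C_T` (S3e) against
`hb_ℓ(F) ≥ 0`: constant `C := A·C_T`. -/
theorem stub_plantedTerminal :
    ∀ (G : Type) [Group G] [TopologicalSpace G] [IsTopologicalGroup G] [CompactSpace G]
      [MeasurableSpace G] [BorelSpace G] (r : LatticeRep G) (β : ℝ),
      (∃ A B : ℝ, 0 ≤ A ∧ 1 ≤ B ∧
        ∀ (S : ℕ) (μW : Measure (GaugeConfig 4 (2 * S + 1) G)),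
        μW = (wilsonMeasure r.ρ β : Measure (GaugeConfig 4 (2 * S + 1) G)) →
        ∀ (D : Finset (Edge 4 (2 * S + 1))) (F : GaugeConfig 4 (2 * S + 1) G → ℝ),
        Measurable F → (∃ M : ℝ, ∀ U, |F U| ≤ M) →
        ∫ U, (F U - (μW[F | cylinderEvents ((↑D : Set (Edge 4 (2 * S + 1)))ᶜ)]) U) ^ 2 ∂μW ≤
          A * B ^ D.card * ∑ ℓ ∈ D, ∫ U, ∫ g, (F U - F (Function.update U ℓ g)) ^ 2
            ∂((haarProbability G).tilted (fun g' => -β * wilsonAction r.ρ (Function.update U ℓ g'))) ∂μW) →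
      (∀ (A B : ℝ), 0 ≤ A → 1 ≤ B →
        (∀ (S : ℕ) (μW : Measure (GaugeConfig 4 (2 * S + 1) G)),
          μW = (wilsonMeasure r.ρ β : Measure (GaugeConfig 4 (2 * S + 1) G)) →
          ∀ (D : Finset (Edge 4 (2 * S + 1))) (F : GaugeConfig 4 (2 * S + 1) G → ℝ),
          Measurable F → (∃ M : ℝ, ∀ U, |F U| ≤ M) →
          ∫ U, (F U - (μW[F | cylinderEvents ((↑D : Set (Edge 4 (2 * S + 1)))ᶜ)]) U) ^ 2 ∂μW ≤
            A * B ^ D.card * ∑ ℓ ∈ D, ∫ U, ∫ g, (F U - F (Function.update U ℓ g)) ^ 2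
              ∂((haarProbability G).tilted (fun g' => -β * wilsonAction r.ρ (Function.update U ℓ g'))) ∂μW) →
        ∀ (S : ℕ) (μW : Measure (GaugeConfig 4 (2 * S + 1) G)),
        μW = (wilsonMeasure r.ρ β : Measure (GaugeConfig 4 (2 * S + 1) G)) →
        ∀ (Λ : Finset (Edge 4 (2 * S + 1))) (c : Edge 4 (2 * S + 1) → ℕ),
        (∀ (y : Site 4 (2 * S + 1)) (i j : Fin 4), i < j →
          ∀ e ∈ ({(y, i), (y.shift i, j), (y.shift j, i), (y, j)} : Finset (Edge 4 (2 * S + 1))),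
          ∀ e' ∈ ({(y, i), (y.shift i, j), (y.shift j, i), (y, j)} : Finset (Edge 4 (2 * S + 1))),
          e ∉ Λ → e' ∉ Λ → c e = c e') →
        ∀ (F : GaugeConfig 4 (2 * S + 1) G → ℝ), Measurable F → (∃ M : ℝ, ∀ U, |F U| ≤ M) →
        ∫ U, (F U - (μW[F | cylinderEvents (↑Λ : Set (Edge 4 (2 * S + 1)))]) U) ^ 2 ∂μW ≤
          ∑ ℓ ∈ Finset.univ.filter (fun ℓ : Edge 4 (2 * S + 1) => ℓ ∉ Λ),
            A * B ^ (Finset.univ.filter (fun ℓ' : Edge 4 (2 * S + 1) => ℓ' ∉ Λ ∧ c ℓ' = c ℓ)).card *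
              ∫ U, ∫ g, (F U - F (Function.update U ℓ g)) ^ 2
                ∂((haarProbability G).tilted (fun g' => -β * wilsonAction r.ρ (Function.update U ℓ g'))) ∂μW) →
      (∀ (B : ℝ), 1 ≤ B → ∃ ε₀ : ℝ, 0 < ε₀ ∧ ε₀ < 1 ∧ ∀ ε : ℝ, 0 < ε → ε ≤ ε₀ → ∃ C : ℝ, 0 ≤ C ∧
        ∀ (S : ℕ), ∃ c : Finset (Edge 4 (2 * S + 1)) → Edge 4 (2 * S + 1) → ℕ,
          (∀ (Λ : Finset (Edge 4 (2 * S + 1))) (y : Site 4 (2 * S + 1)) (i j : Fin 4), i < j →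
            ∀ e ∈ ({(y, i), (y.shift i, j), (y.shift j, i), (y, j)} : Finset (Edge 4 (2 * S + 1))),
            ∀ e' ∈ ({(y, i), (y.shift i, j), (y.shift j, i), (y, j)} : Finset (Edge 4 (2 * S + 1))),
            e ∉ Λ → e' ∉ Λ → c Λ e = c Λ e') ∧
          ∀ ℓ : Edge 4 (2 * S + 1),
            ∑ Λ ∈ (Finset.univ : Finset (Finset (Edge 4 (2 * S + 1)))).filter (fun Λ => ℓ ∉ Λ),
              ε ^ (Fintype.card (Edge 4 (2 * S + 1)) - Λ.card) * (1 - ε) ^ Λ.card *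
                B ^ (Finset.univ.filter (fun ℓ' : Edge 4 (2 * S + 1) => ℓ' ∉ Λ ∧ c Λ ℓ' = c Λ ℓ)).card ≤ C) →
      ∃ ε₀ : ℝ, 0 < ε₀ ∧ ε₀ < 1 ∧ ∀ ε : ℝ, 0 < ε → ε ≤ ε₀ → ∃ C : ℝ, 0 ≤ C ∧
        ∀ (S : ℕ) (μW : Measure (GaugeConfig 4 (2 * S + 1) G)),
        μW = (wilsonMeasure r.ρ β : Measure (GaugeConfig 4 (2 * S + 1) G)) →
        ∀ (F : GaugeConfig 4 (2 * S + 1) G → ℝ), Measurable F → (∃ M : ℝ, ∀ U, |F U| ≤ M) →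
        (∑ Λ : Finset (Edge 4 (2 * S + 1)),
          ε ^ (Fintype.card (Edge 4 (2 * S + 1)) - Λ.card) * (1 - ε) ^ Λ.card *
            ∫ U, condVar (⨆ ℓ ∈ Λ, MeasurableSpace.comap (fun V : GaugeConfig 4 (2 * S + 1) G => V ℓ) inferInstance)
              F μW U ∂μW) ≤
          C * ∑ ℓ : Edge 4 (2 * S + 1), ∫ U, ∫ g, (F U - F (Function.update U ℓ g)) ^ 2
            ∂((haarProbability G).tilted (fun g' => -β * wilsonAction r.ρ (Function.update U ℓ g'))) ∂μW :=
  Summit.QuantumFields.YangMills.Theorems.SusceptibilityToPoincare.stub_plantedTerminal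

/-- `stub_plantedLocalToGlobal` — **S4 · planted local-to-global for simply-connected simple `G`** (HARDEST, load-bearing, OPEN —
held by the lead; the crux's content in the line's form).  For compact simple SIMPLY-CONNECTED `G`, faithful unitary `r`,
`β ≥ 0`: IF EB(r, β) (= S2) AND FS(r, β), THEN for every `ε₀ > 0` there are a free density `0 < ε ≤ ε₀` and `C ≥ 0` with
`Var_μ F ≤ C·PCV_ε(F)` for all `S` and all gauge-invariant bounded measurable `F`.  Intended proof: the planner's card (Chen–Eldan
coordinate-by-coordinate Doob localisation with planted pins; law of total variance along the revelation martingale; pins on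
forests are pure gauge; framed free links respond through local invariant composites = FS susceptibilities; share-localised
spectral independence).  STATUS (lead, 2026-08-16): AS TYPED (all β ≥ 0, all faithful r) S4 is refuted MODULO the SU(2) twist
inputs of drefute's `Negative/TwistSectorSimplyConnected.lean` (p77766): S4 ∘ S1 ∘ S2 ∘ S3 is UP_inv for simply-connected G,
false there in the Bhanot–Creutz window of `r = ρ_½ ⊕ ρ₁^{⊕k}`; the honest re-typing is `∃ β₁(G,r) ∀ β ≥ β₁` (or `r` irreducible),
which leaves S1–S3, S5 verbatim.  Beyond the re-typing it is the shared open core of all three lines (= orbit-slice 4a = maxcorr A2). -/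
theorem stub_plantedLocalToGlobal :
    ∀ (G : Type) [Group G] [TopologicalSpace G] [IsTopologicalGroup G] [CompactSpace G]
      [MeasurableSpace G] [BorelSpace G], IsCompactSimpleLieGroup G → SimplyConnectedSpace G →
      ∀ (r : LatticeRep G) (β : ℝ), 0 ≤ β →
      (∀ (S : ℕ), 1 ≤ S → ∀ (μW : Measure (GaugeConfig 4 (2 * S + 1) G)),
        μW = (wilsonMeasure r.ρ β : Measure (GaugeConfig 4 (2 * S + 1) G)) →
        ∀ φ : GaugeConfig 4 (2 * S + 1) G → ℝ, Measurable φ → (∃ M : ℝ, ∀ U, |φ U| ≤ M) →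
        ∑ ℓ : Edge 4 (2 * S + 1),
            variance (μW[φ | MeasurableSpace.comap (fun V : GaugeConfig 4 (2 * S + 1) G => V ℓ) inferInstance]) μW ≤
          variance φ μW) →
      (∀ A B : YMSpecies G, ∃ χ : ℝ, ∀ S : ℕ, ∑ x ∈ Literature.Probability.LatticeModels.box 4 S,
        |covariance (fun U => A.F (Literature.MathematicalPhysics.QuantumLattice.torusLift (2 * S + 1) U))
          (fun U => B.F (Literature.MathematicalPhysics.QuantumLattice.configShift (-x)
          (Literature.MathematicalPhysics.QuantumLattice.torusLift (2 * S + 1) U)))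
          (wilsonMeasure r.ρ β : Measure (GaugeConfig 4 (2 * S + 1) G))| ≤ χ) →
      ∀ ε₀ : ℝ, 0 < ε₀ → ∃ ε : ℝ, 0 < ε ∧ ε ≤ ε₀ ∧ ∃ C : ℝ, 0 ≤ C ∧
        ∀ (S : ℕ) (μW : Measure (GaugeConfig 4 (2 * S + 1) G)),
        μW = (wilsonMeasure r.ρ β : Measure (GaugeConfig 4 (2 * S + 1) G)) →
        ∀ (F : GaugeConfig 4 (2 * S + 1) G → ℝ), Measurable F → (∃ M : ℝ, ∀ U, |F U| ≤ M) →
        IsGaugeInvariant F →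
        variance F μW ≤
          C * ∑ Λ : Finset (Edge 4 (2 * S + 1)),
            ε ^ (Fintype.card (Edge 4 (2 * S + 1)) - Λ.card) * (1 - ε) ^ Λ.card *
              ∫ U, condVar (⨆ ℓ ∈ Λ, MeasurableSpace.comap (fun V : GaugeConfig 4 (2 * S + 1) G => V ℓ) inferInstance)
                F μW U ∂μW := by
  sorry

/-- `stub_centrelessResidual` — **S5 · the centreless residual — scope sentinel, NOT claimed by the line, NOT to be staffed**.
`IsCompactSimpleLieGroup` admits compact simple `G` with `π₁(G) ≠ 0` (SO(3), PSU(N), …), where `Disproof.lean` §2 proves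
`¬ crux` MODULO `H = TwistSectorInputs` (p76563: 't Hooft magnetic-twist sectors are gauge-invariant slow modes of the heat bath)
— and the same `H` kills this stub (Disproof §3 pattern).  It is the crux's implication FS ⇒ UP_inv restricted to
`¬ SimplyConnectedSpace G`, registered only so that the composition covers the crux AS TYPED; a refutation BY NAME re-scopes the
crux to `SimplyConnectedSpace G` (planner) and leaves S1–S4 verbatim. -/
theorem stub_centrelessResidual :
    ∀ (G : Type) [Group G] [TopologicalSpace G] [IsTopologicalGroup G] [CompactSpace G]
      [MeasurableSpace G] [BorelSpace G], IsCompactSimpleLieGroup G → ¬ SimplyConnectedSpace G →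
      ∀ (r : LatticeRep G) (β : ℝ), 0 ≤ β →
      (∀ A B : YMSpecies G, ∃ χ : ℝ, ∀ S : ℕ, ∑ x ∈ Literature.Probability.LatticeModels.box 4 S,
        |covariance (fun U => A.F (Literature.MathematicalPhysics.QuantumLattice.torusLift (2 * S + 1) U))
          (fun U => B.F (Literature.MathematicalPhysics.QuantumLattice.configShift (-x)
          (Literature.MathematicalPhysics.QuantumLattice.torusLift (2 * S + 1) U)))
          (wilsonMeasure r.ρ β : Measure (GaugeConfig 4 (2 * S + 1) G))| ≤ χ) →
      ∃ C : ℝ, ∀ (S : ℕ) (μW : Measure (GaugeConfig 4 (2 * S + 1) G)),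
        μW = (wilsonMeasure r.ρ β : Measure (GaugeConfig 4 (2 * S + 1) G)) →
        ∀ (F : GaugeConfig 4 (2 * S + 1) G → ℝ), Measurable F → (∃ M : ℝ, ∀ U, |F U| ≤ M) →
        IsGaugeInvariant F →
        variance F μW ≤
          C * ∑ ℓ : Edge 4 (2 * S + 1), ∫ U, ∫ g, (F U - F (Function.update U ℓ g)) ^ 2
            ∂((haarProbability G).tilted (fun g' => -β * wilsonAction r.ρ (Function.update U ℓ g'))) ∂μW := by
  sorry

/-! ### §3 The kernel-checked composition (sorry-free) -/

section Glue

variable {G : Type} [Group G] [TopologicalSpace G] [IsTopologicalGroup G] [CompactSpace G]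
  [MeasurableSpace G] [BorelSpace G]

/-- S2 in vocabulary form. -/
theorem eb_of_stub (h : type_of% stub_elitzurBessel) (r : LatticeRep G) (β : ℝ) : EB r β :=
  fun S hS μW hμ φ hφ hb => h G r β S hS μW hμ φ hφ hb

/-- S3 in vocabulary form, from S3c, S3d, S3e via S3f. -/
theorem plantedTerminal_of_stubs (h3c : type_of% stub_linkSetPoincare) (h3d : type_of% stub_pinnedClusterBound)
    (h3e : type_of% stub_freeClusterTail) (h3f : type_of% stub_plantedTerminal) (r : LatticeRep G) (β : ℝ) :
    PlantedTerminal r β :=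
  h3f G r β (h3c G r β) (h3d G r β) h3e

/-- S4 in vocabulary form. -/
theorem plantedLocalToGlobal_of_stub (h4 : type_of% stub_plantedLocalToGlobal) (hG : IsCompactSimpleLieGroup G)
    (hsc : SimplyConnectedSpace G) (r : LatticeRep G) (β : ℝ) (hβ : 0 ≤ β) (hEB : EB r β) (hFS : FS r β) :
    PlantedLocalToGlobal r β :=
  h4 G hG hsc r β hβ hEB hFS

/-- Middle + terminal stage ⇒ UP_inv (constant `C_M · C_T` at a common free density `ε ≤ ε₀`). -/
theorem upInv_of_planted (r : LatticeRep G) (β : ℝ) (hT : PlantedTerminal r β) (hM : PlantedLocalToGlobal r β) :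
    UPInv r β := by
  obtain ⟨ε₀, hε₀, -, hT⟩ := hT
  obtain ⟨ε, hε, hεε₀, CM, hCM, hM⟩ := hM ε₀ hε₀
  obtain ⟨CT, -, hCT⟩ := hT ε hε hεε₀
  refine ⟨CM * CT, fun S F hF hbd hinv => ?_⟩
  have h1 := hM S _ rfl F hF hbd hinv
  have h2 := hCT S _ rfl F hF hbd
  calc variance F (wilsonMeasure (d := 4) (L := 2 * S + 1) r.ρ β)
      ≤ CM * _ := h1
    _ ≤ CM * (CT * _) := mul_le_mul_of_nonneg_left h2 hCM
    _ = CM * CT * _ := by ring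

/-- S5 in vocabulary form. -/
theorem upInv_of_residual (h5 : type_of% stub_centrelessResidual) (hG : IsCompactSimpleLieGroup G)
    (hsc : ¬ SimplyConnectedSpace G) (r : LatticeRep G) (β : ℝ) (hβ : 0 ≤ β) (hFS : FS r β) : UPInv r β := by
  obtain ⟨C, hC⟩ := h5 G hG hsc r β hβ hFS
  exact ⟨C, fun S F hF hbd hinv => hC S _ rfl F hF hbd hinv⟩

/-- **Composition** (sorry-free, standard axioms): the registered stub STATEMENTS imply the crux in its unfolded form —
UP_inv from the planted chain S2–S4 (simply-connected `G`) or the residual S5 (centreless `G`), then UP by the transfer S1. -/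
theorem composition (h2 : type_of% stub_elitzurBessel) (h3c : type_of% stub_linkSetPoincare)
    (h3d : type_of% stub_pinnedClusterBound) (h3e : type_of% stub_freeClusterTail) (h3f : type_of% stub_plantedTerminal)
    (h4 : type_of% stub_plantedLocalToGlobal) (h5 : type_of% stub_centrelessResidual) :
    ∀ (G : Type) [Group G] [TopologicalSpace G] [IsTopologicalGroup G] [CompactSpace G]
      [MeasurableSpace G] [BorelSpace G], IsCompactSimpleLieGroup G →
      ∀ (r : LatticeRep G) (β : ℝ), 0 ≤ β → FS r β → UP r β := by
  intro G _ _ _ _ _ _ hG r β hβ hFS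
  refine orbitSlice G r β ?_
  by_cases hsc : SimplyConnectedSpace G
  · exact upInv_of_planted r β (plantedTerminal_of_stubs h3c h3d h3e h3f r β)
      (plantedLocalToGlobal_of_stub h4 hG hsc r β hβ (eb_of_stub h2 r β) hFS)
  · exact upInv_of_residual h5 hG hsc r β hβ hFS

end Glue

/-- **The skeleton theorem**: the crux BY NAME from the seven registered stubs. -/
theorem SusceptibilityToPoincare_of :
    Summit.QuantumFields.YangMills.Theses.FradkinShenkerFlow.SusceptibilityToPoincare :=
  crux_iff.2 (composition stub_elitzurBessel stub_linkSetPoincare stub_pinnedClusterBound stub_freeClusterTail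
    stub_plantedTerminal stub_plantedLocalToGlobal stub_centrelessResidual)

end

end Summit.QuantumFields.YangMills.Cruxes.SusceptibilityToPoincare.PlantedLinkPinning
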